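import Mathlib.LinearAlgebra.Dual.Lemmas
import Literature.Computability.AlgebraicComplexity.MS21DiagonalTensorDerivatives
import HarnessLib

/-!
# Medini–Shpilka 2021, Thm 45 (difference of two diagonal-tensor orbits): the algebra of the
# printed case analysis

Theorem-only support file (cell `val-lit`, seat x6 g3) for the typed fact `MS2021_thm_45`
(`f₁ ∈ T_{s₁,d₁}^{GL_n}`, `f₂ ∈ T_{s₂,d₂}^{GL_n}`, `f = f₁ - f₂ ≠ 0` ⇒ `f ∘ G ≠ 0` for every uniform
`6`-independent `G`). The printed proof [MediniShpilka2021, §6.2, proof of Thm 45 = arXiv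
‹PITsumSDMinv›, p0036:L1-L52] is a case analysis on top of Lemma 6.2 / Cor 6.3 (the "engine":
`(k+2)`-independent maps hit nonzero `k`-th directional derivatives of `T^{GLaff}` polynomials —
seat t18 g5's `MS21DiagonalTensorDerivatives.lean`). THIS file holds the engine-free algebra of
that case analysis, on the canonical diagonal tensor written with PAIR indices,
`T'_{s,d} = ∑_{a<s} ∏_{j<d} x_{(a,j)} ∈ K[x_{(a,j)}]` (the tree's `MS2021.sdm K s d` is its renaming
along `finProdFinEquiv`, `sdm_eq_rename`):

* the monomials of `T'_{s,d}` are the ROW monomials `∑_j e_{(a,j)}` (`coeff_sum_prod_X`), it is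
  homogeneous of degree `d`, every second derivative `∂²/∂x_v ∂x_{v'}` with `v = v'` or `v, v'` in
  different rows kills it ("`∂² T/∂x_{i,j}∂x_{i',j'} = 0`", p0035:L10-L12; `pderiv_pderiv_sum_prod_X`),
  and a directional derivative `∑_w λ_w ∂/∂x_w` with some `λ_{v₀} ≠ 0` does not (`d ≥ 2`;
  "from linear independence we get that `∂(∏_j ℓ_{1,1,j})/∂v ≠ 0`", p0036:L21; `dirDeriv_sum_prod_X_ne_zero`);
* Case "the `{ℓ_1}`-monomials of `f₂` are `{ℓ_1}`-monomials of `f₁`" (p0036:L29-L31): the derivative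
  of a combination of row monomials along `x_{(a₀,j₀)}` is a constant times a product of the other
  variables of row `a₀` (`pderiv_eq_C_mul_prod_of_rows`);
* Case "some `{ℓ_1}`-monomial of `f₂` is not one of `f₁`" (p0036:L33-L50): the coefficients of the
  two second derivatives used there (`coeff_pderiv_pderiv_of_two_le` — a square, coefficient
  `α_v (α_v - 1) c_α`; `coeff_pderiv_pderiv_of_ne` — two distinct linear variables, coefficient
  `c_α`), and the combinatorial fact that a degree-`d` multilinear non-row monomial meets two rows
  (`exists_two_rows_of_not_row`);
* the transfer to the orbit: chain rule along an arbitrary direction for `g(Ax + b)`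
  (`dirDeriv_affSubst_rename`, from the tree's `MS2021.dirDeriv_affSubst`, seat t18 g5), injectivity of `g ↦ g(Ax+b)`
  (`eq_zero_of_affSubst_eq_zero`, from `MS2021.aeval_affine_inv_apply`), homogeneity, and the linear
  algebra of the spans of the two families of linear forms ("fix a vector `v` such that
  `ℓ_{1,1,1}(v) = 1` and `ℓ_{2,i,j}(v) = 0`", p0036:L19 — `exists_dotProduct_eq_one_of_notMem_span`;
  equal spans force `s₁ = s₂` — `card_eq_of_span_eq`; "we can represent `f₂` as a polynomial in
  `{ℓ_{1,i,j}}`", p0036:L26 — `exists_matrix_of_span_le`).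

CHARACTERISTIC NOTE (ours, recorded for the referees and the erratum registry): in the sub-case
"some `a_{i,j} ≥ 2`" (p0036:L38-L42) the printed proof uses `∂²f₂/∂x_{i,j}² ≠ 0` "as the monomial
exists in `f₂`"; the relevant coefficient is `a_{i,j}(a_{i,j} - 1) · c` (`coeff_pderiv_pderiv_of_two_le`),
which vanishes in characteristic `p` when `p ∣ a_{i,j}(a_{i,j} - 1)` (possible when `p ≤ d`). The
assembly file therefore proves Thm 45 under the hypothesis `char K = 0 ∨ char K > max d₁ d₂`
(all `1 ≤ q ≤ d` nonzero in `K`); every other step here is characteristic-free.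

No definitions, no facts (D-0026). HONEST FRAMING: infrastructure; `VP ≠ VNP` is NOT proved.

## References
* [MediniShpilka2021] D. Medini, A. Shpilka, CCC 2021 (LIPIcs 200:19): Thm 45 (p.19:14) and its
  proof, arXiv:2102.05632 §6.2 (held text p0035:L53-L60, p0036:L1-L52); Lemma 3.8 (p0017:L61-L68);
  Def 40 (`T_{s,d}`).
-/

noncomputable section

open MvPolynomial Matrix

namespace Literature.Computability.AlgebraicComplexity

namespace MS2021

/-! ### The pair-indexed diagonal tensor `∑_a ∏_j x_{(a,j)}`: monomials, degree, derivatives -/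

section PairTensor

variable {K : Type*} [CommRing K] {s d : ℕ}

/-- The row exponent `∑_j e_{(a,j)}` evaluated: `1` on row `a`, `0` elsewhere (the exponent of the
`a`-th "variable-disjoint monomial" of `T_{s,d}`). [cite: MediniShpilka2021, Def 40 (CCC p.19:13; arXiv p0008:L51-L53)] -/
theorem rowExp_apply (a : Fin s) (v : Fin s × Fin d) :
    (∑ j : Fin d, Finsupp.single (a, j) 1 : Fin s × Fin d →₀ ℕ) v = if v.1 = a then 1 else 0 := by
  classical
  rw [Finset.sum_apply']
  rcases v with ⟨a', j'⟩
  simp only [Finsupp.single_apply, Prod.mk.injEq]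
  by_cases h : a' = a
  · subst h
    simp
  · rw [if_neg h]
    exact Finset.sum_eq_zero fun j _ => if_neg fun hh => h hh.1.symm

/-- Distinct rows have distinct row exponents (when rows are non-empty, `0 < d`) — "a sum of `s`
variable-disjoint monomials". [cite: MediniShpilka2021, Def 40 (CCC p.19:13; arXiv p0008:L51-L53)] -/
theorem rowExp_injective (hd : 0 < d) {a a' : Fin s}
    (h : (∑ j : Fin d, Finsupp.single (a, j) 1 : Fin s × Fin d →₀ ℕ) =
      ∑ j : Fin d, Finsupp.single (a', j) 1) : a = a' := by
  have := congr_arg (fun e : Fin s × Fin d →₀ ℕ => e (a, ⟨0, hd⟩)) h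
  simp only [rowExp_apply] at this
  by_contra hne
  rw [if_neg hne] at this
  exact one_ne_zero this

/-- A row product is the monomial of the row exponent: `∏_j x_{(a,j)} = x^{∑_j e_{(a,j)}}`.
[cite: MediniShpilka2021, Def 40 (CCC p.19:13; arXiv ‹Def 1.24› p0008:L51-L53)] -/
theorem prod_X_row_eq_monomial (a : Fin s) :
    (∏ j : Fin d, X (a, j) : MvPolynomial (Fin s × Fin d) K) =
      monomial (∑ j : Fin d, Finsupp.single (a, j) 1) 1 := by
  rw [monomial_sum_index, C_1, one_mul]
  rfl

/-- **The monomials of `T'_{s,d}`** (`0 < d`): the coefficient of `x^α` in `∑_a ∏_j x_{(a,j)}` is `1`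
if `α` is a row exponent and `0` otherwise. [cite: MediniShpilka2021, Def 40 ("a sum of `s` variable-disjoint monomials"; arXiv p0008:L51-L53)] -/
theorem coeff_sum_prod_X (hd : 0 < d) (α : Fin s × Fin d →₀ ℕ) :
    coeff α (∑ a : Fin s, ∏ j : Fin d, X (a, j) : MvPolynomial (Fin s × Fin d) K) =
      if ∃ a : Fin s, α = ∑ j : Fin d, Finsupp.single (a, j) 1 then 1 else 0 := by
  classical
  simp_rw [prod_X_row_eq_monomial, coeff_sum, coeff_monomial]
  split_ifs with h
  · obtain ⟨a₀, rfl⟩ := h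
    rw [Finset.sum_eq_single a₀]
    · rw [if_pos rfl]
    · intro a _ ha
      rw [if_neg]
      exact fun heq => ha (rowExp_injective hd heq)
    · intro ha
      exact absurd (Finset.mem_univ a₀) ha
  · exact Finset.sum_eq_zero fun a _ => if_neg fun heq => h ⟨a, heq.symm⟩

/-- `T'_{s,d}` is homogeneous of degree `d`. [cite: MediniShpilka2021, Def 40 (arXiv p0008:L51-L53)] -/
theorem isHomogeneous_sum_prod_X :
    (∑ a : Fin s, ∏ j : Fin d, X (a, j) : MvPolynomial (Fin s × Fin d) K).IsHomogeneous d := by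
  refine IsHomogeneous.sum _ _ _ fun a _ => ?_
  have := IsHomogeneous.prod Finset.univ (fun j : Fin d => (X (a, j) : MvPolynomial (Fin s × Fin d) K))
    (fun _ => 1) fun j _ => isHomogeneous_X _ _
  simpa using this

/-- **`∂² T'/∂x_v ∂x_{v'} = 0`** when `v = v'` (the tensor is multilinear) or `v`, `v'` lie in
different rows (each monomial lives in one row) — "for any two variables in distinct product gates
… `∂² T_{s,d}/∂x_{i,j}∂x_{i',j'} = 0`", and the square case of p0036:L40.
[cite: MediniShpilka2021, §6.2 (arXiv p0035:L10-L12) and proof of Thm 45 (p0036:L38-L47)] -/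
theorem pderiv_pderiv_sum_prod_X (v v' : Fin s × Fin d) (h : v = v' ∨ v.1 ≠ v'.1) :
    pderiv v (pderiv v' (∑ a : Fin s, ∏ j : Fin d, X (a, j) : MvPolynomial (Fin s × Fin d) K)) =
      0 := by
  classical
  simp_rw [prod_X_row_eq_monomial, map_sum, pderiv_monomial]
  refine Finset.sum_eq_zero fun a _ => ?_
  rw [monomial_eq_zero]
  have h1 : (∑ j : Fin d, Finsupp.single (a, j) 1 : Fin s × Fin d →₀ ℕ) v' =
      if v'.1 = a then 1 else 0 := rowExp_apply a v'
  have h2 : ((∑ j : Fin d, Finsupp.single (a, j) 1 : Fin s × Fin d →₀ ℕ) -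
      Finsupp.single v' 1 : Fin s × Fin d →₀ ℕ) v =
      (if v.1 = a then 1 else 0) - (Finsupp.single v' 1 v) := by
    rw [Finsupp.tsub_apply, rowExp_apply]
  rcases h with rfl | hne
  · rw [h2, Finsupp.single_eq_same]
    by_cases hv : v.1 = a
    · simp [hv]
    · simp [hv]
  · by_cases hv' : v'.1 = a
    · have hv : v.1 ≠ a := fun h => hne (h.trans hv'.symm)
      rw [h2, if_neg hv]
      simp
    · rw [h1, if_neg hv']
      simp

/-- **A directional derivative `∑_w λ_w ∂T'/∂x_w` with `λ_{v₀} ≠ 0` is nonzero** (`d ≥ 2`): the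
monomial "row of `v₀` without `v₀`" has coefficient `λ_{v₀}` ("from linear independence we get that
`∂(∏_j ℓ_{1,1,j})/∂v ≠ 0` and, the same argument also gives `∂f₁/∂v ≠ 0`").
[cite: MediniShpilka2021, proof of Thm 45 (arXiv p0036:L19-L22)] -/
theorem dirDeriv_sum_prod_X_ne_zero [IsDomain K] (hd : 2 ≤ d) (lam : Fin s × Fin d → K)
    (v₀ : Fin s × Fin d) (hv₀ : lam v₀ ≠ 0) :
    (∑ w, C (lam w) * pderiv w (∑ a : Fin s, ∏ j : Fin d, X (a, j) :
      MvPolynomial (Fin s × Fin d) K)) ≠ 0 := by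
  classical
  have hd0 : 0 < d := by omega
  set m₀ : Fin s × Fin d →₀ ℕ :=
    (∑ j : Fin d, Finsupp.single (v₀.1, j) 1) - Finsupp.single v₀ 1 with hm₀
  -- which `m₀ + e_w` are row exponents: only `w = v₀`
  have key : ∀ w : Fin s × Fin d,
      (∃ a : Fin s, m₀ + Finsupp.single w 1 = ∑ j : Fin d, Finsupp.single (a, j) 1) ↔ w = v₀ := by
    intro w
    constructor
    · rintro ⟨a, ha⟩
      obtain ⟨j₁, hj₁⟩ : ∃ j₁ : Fin d, j₁ ≠ v₀.2 := by
        by_cases h0 : v₀.2 = ⟨0, hd0⟩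
        · exact ⟨⟨1, hd⟩, fun h => by rw [h0] at h; exact absurd (congr_arg Fin.val h) (by simp)⟩
        · exact ⟨⟨0, hd0⟩, fun h => h0 h.symm⟩
      have hne1 : (v₀.1, j₁) ≠ v₀ := fun h => hj₁ (congr_arg Prod.snd h)
      have hm1 : m₀ (v₀.1, j₁) = 1 := by
        rw [hm₀, Finsupp.tsub_apply, rowExp_apply, if_pos rfl, Finsupp.single_apply,
          if_neg hne1.symm, tsub_zero]
      have ha' : v₀.1 = a := by
        have e1 := congr_arg (fun e : Fin s × Fin d →₀ ℕ => e (v₀.1, j₁)) ha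
        simp only [Finsupp.add_apply, hm1, rowExp_apply] at e1
        by_contra hne
        rw [if_neg hne] at e1
        omega
      subst ha'
      have hm0 : m₀ v₀ = 0 := by
        rw [hm₀, Finsupp.tsub_apply, rowExp_apply, if_pos rfl, Finsupp.single_apply, if_pos rfl]
      have e2 := congr_arg (fun e : Fin s × Fin d →₀ ℕ => e v₀) ha
      simp only [Finsupp.add_apply, hm0, rowExp_apply, zero_add, Finsupp.single_apply] at e2
      simp only [if_true] at e2
      by_contra hw
      rw [if_neg hw] at e2
      exact zero_ne_one e2
    · intro hw
      rw [hw]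
      refine ⟨v₀.1, ?_⟩
      rw [hm₀, tsub_add_cancel_of_le]
      refine Finsupp.single_le_iff.2 ?_
      rw [rowExp_apply, if_pos rfl]
  intro h0
  have hc := congr_arg (coeff m₀) h0
  rw [coeff_sum, coeff_zero] at hc
  simp only [coeff_C_mul, coeff_pderiv, coeff_sum_prod_X hd0, key] at hc
  rw [Finset.sum_eq_single v₀ (fun w _ hw => by rw [if_neg hw]; ring)
    (fun h => absurd (Finset.mem_univ v₀) h), if_pos rfl] at hc
  have hm₀v : m₀ v₀ = 0 := by
    rw [hm₀, Finsupp.tsub_apply, rowExp_apply, if_pos rfl, Finsupp.single_eq_same]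
  rw [hm₀v] at hc
  simp only [Nat.cast_zero, zero_add, mul_one] at hc
  exact hv₀ hc

/-- **Case "the monomials of `f₂` are monomials of `f₁`"**: for a combination `Q` of ROW monomials,
`∂Q/∂x_{(a₀,j₀)} = c_{a₀} · ∏_{j ≠ j₀} x_{(a₀,j)}` — a constant times a product of variables
("`f = ∑_i (1 + α_i) ∏_j ℓ_{1,i,j}`", p0036:L30; we differentiate once instead of invoking Cor 6.3 on
the re-presented `f`). [cite: MediniShpilka2021, proof of Thm 45 (arXiv p0036:L29-L31)] -/
theorem pderiv_eq_C_mul_prod_of_rows (Q : MvPolynomial (Fin s × Fin d) K)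
    (hQ : ∀ α ∈ Q.support, ∃ a : Fin s, α = ∑ j : Fin d, Finsupp.single (a, j) 1)
    (a₀ : Fin s) (j₀ : Fin d) :
    pderiv (a₀, j₀) Q =
      C (coeff (∑ j : Fin d, Finsupp.single (a₀, j) 1) Q) * ∏ j ∈ Finset.univ.erase j₀, X (a₀, j) := by
  classical
  have hd0 : 0 < d := j₀.pos
  -- the product of the other variables of row `a₀` is the monomial `rowExp a₀ - e_{(a₀,j₀)}`
  have hmon : (monomial ((∑ j : Fin d, Finsupp.single (a₀, j) 1) - Finsupp.single (a₀, j₀) 1)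
      (coeff (∑ j : Fin d, Finsupp.single (a₀, j) 1) Q) : MvPolynomial (Fin s × Fin d) K) =
      C (coeff (∑ j : Fin d, Finsupp.single (a₀, j) 1) Q) * ∏ j ∈ Finset.univ.erase j₀, X (a₀, j) := by
    have hsub : (∑ j : Fin d, Finsupp.single (a₀, j) 1 : Fin s × Fin d →₀ ℕ) -
        Finsupp.single (a₀, j₀) 1 = ∑ j ∈ Finset.univ.erase j₀, Finsupp.single (a₀, j) 1 := by
      rw [← Finset.add_sum_erase Finset.univ _ (Finset.mem_univ j₀), add_tsub_cancel_left]
    rw [hsub, monomial_sum_index]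
    rfl
  rw [← hmon]
  conv_lhs => rw [Q.as_sum, map_sum]
  simp only [pderiv_monomial]
  -- only the row `a₀` term survives
  rw [Finset.sum_eq_single (∑ j : Fin d, Finsupp.single (a₀, j) 1)]
  · rw [rowExp_apply, if_pos rfl, Nat.cast_one, mul_one]
  · intro α hα hne
    obtain ⟨a, rfl⟩ := hQ α hα
    have ha : a ≠ a₀ := fun h => hne (by rw [h])
    rw [rowExp_apply, if_neg (Ne.symm ha), Nat.cast_zero, mul_zero, monomial_zero]
  · intro hns
    rw [notMem_support_iff.1 hns, zero_mul, monomial_zero]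

/-- Coefficient of a repeated second derivative: `[x^{α - 2e_v}] ∂²P/∂x_v² = α_v (α_v - 1) · [x^α] P`
(`α_v ≥ 2`) — the quantity the printed sub-case "some `a_{i,j} ≥ 2`" needs to be nonzero; it is,
PROVIDED `α_v` and `α_v - 1` are nonzero in `K` (characteristic note in the module docstring).
[cite: MediniShpilka2021, proof of Thm 45 (arXiv p0036:L38-L42)] -/
theorem coeff_pderiv_pderiv_of_two_le {σ : Type*} (P : MvPolynomial σ K) (v : σ) (α : σ →₀ ℕ)
    (h2 : 2 ≤ α v) :
    coeff (α - Finsupp.single v 2) (pderiv v (pderiv v P)) =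
      coeff α P * ((α v - 1 : ℕ) : K) * ((α v : ℕ) : K) := by
  classical
  rw [coeff_pderiv, coeff_pderiv]
  have e1 : α - Finsupp.single v 2 + Finsupp.single v 1 + Finsupp.single v 1 = α := by
    rw [add_assoc, ← Finsupp.single_add, tsub_add_cancel_of_le (Finsupp.single_le_iff.2 h2)]
  have e2 : (α - Finsupp.single v 2 + Finsupp.single v 1 : σ →₀ ℕ) v + 1 = α v := by
    simp only [Finsupp.add_apply, Finsupp.tsub_apply, Finsupp.single_eq_same]; omega
  have e3 : (α - Finsupp.single v 2 : σ →₀ ℕ) v + 1 = α v - 1 := by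
    simp only [Finsupp.tsub_apply, Finsupp.single_eq_same]; omega
  rw [e1, ← Nat.cast_succ, ← Nat.cast_succ, Nat.succ_eq_add_one, Nat.succ_eq_add_one, e2, e3]
  ring

/-- Coefficient of a mixed second derivative in two LINEAR variables of `x^α` (`α_v = α_{v'} = 1`,
`v ≠ v'`): `[x^{α - e_v - e_{v'}}] ∂²P/∂x_v∂x_{v'} = [x^α] P` — characteristic-free ("it is easy to
verify that … `∂²f₂/∂u∂w ≠ 0`", sub-case "`a_{i,j} ≤ 1` for every `i, j`").
[cite: MediniShpilka2021, proof of Thm 45 (arXiv p0036:L44-L48)] -/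
theorem coeff_pderiv_pderiv_of_ne {σ : Type*} (P : MvPolynomial σ K) (v v' : σ) (hne : v ≠ v')
    (α : σ →₀ ℕ) (hv : α v = 1) (hv' : α v' = 1) :
    coeff (α - Finsupp.single v 1 - Finsupp.single v' 1) (pderiv v (pderiv v' P)) = coeff α P := by
  classical
  rw [coeff_pderiv, coeff_pderiv]
  have hsv' : (Finsupp.single v 1 : σ →₀ ℕ) v' = 0 := by
    rw [Finsupp.single_apply, if_neg hne]
  have hsv : (Finsupp.single v' 1 : σ →₀ ℕ) v = 0 := by
    rw [Finsupp.single_apply, if_neg (Ne.symm hne)]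
  have hle' : Finsupp.single v' 1 ≤ α - Finsupp.single v 1 := by
    refine Finsupp.single_le_iff.2 ?_
    rw [Finsupp.tsub_apply, hsv', hv']
  have e1 : α - Finsupp.single v 1 - Finsupp.single v' 1 + Finsupp.single v 1 + Finsupp.single v' 1 =
      α := by
    rw [add_right_comm, tsub_add_cancel_of_le hle',
      tsub_add_cancel_of_le (Finsupp.single_le_iff.2 (by rw [hv]))]
  have e2 : (α - Finsupp.single v 1 - Finsupp.single v' 1 + Finsupp.single v 1 : σ →₀ ℕ) v' = 0 := by
    simp only [Finsupp.add_apply, Finsupp.tsub_apply, Finsupp.single_eq_same, hsv', hv']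
  have e3 : (α - Finsupp.single v 1 - Finsupp.single v' 1 : σ →₀ ℕ) v = 0 := by
    simp only [Finsupp.tsub_apply, Finsupp.single_eq_same, hsv, hv]
  rw [e1, e2, e3]
  simp

/-- A multilinear exponent of degree `d` on the `s × d` grid which is NOT a row exponent meets two
different rows ("since `f₂` is homogeneous, there must be some `i ≠ i'` such that for some `j` and
`j'`, `a_{i,j}, a_{i',j'} ≠ 0`"). [cite: MediniShpilka2021, proof of Thm 45 (arXiv p0036:L44-L45)] -/
theorem exists_two_rows_of_not_row (hd : 0 < d) (α : Fin s × Fin d →₀ ℕ) (hdeg : α.degree = d)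
    (hml : ∀ v, α v ≤ 1) (hrow : ∀ a : Fin s, α ≠ ∑ j : Fin d, Finsupp.single (a, j) 1) :
    ∃ v ∈ α.support, ∃ v' ∈ α.support, v.1 ≠ v'.1 := by
  classical
  by_contra hcon
  push Not at hcon
  -- all of `α.support` lies in one row
  have hcard : α.support.card = d := by
    have h1 : ∀ v ∈ α.support, α v = 1 := fun v hv =>
      le_antisymm (hml v) (Nat.one_le_iff_ne_zero.2 (Finsupp.mem_support_iff.1 hv))
    have : α.degree = ∑ v ∈ α.support, α v := rfl
    rw [this, Finset.sum_congr rfl h1, Finset.sum_const, smul_eq_mul, mul_one] at hdeg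
    exact hdeg
  obtain ⟨v₀, hv₀⟩ : α.support.Nonempty := by
    rw [← Finset.card_pos, hcard]; exact hd
  have hsub : α.support ⊆ (Finset.univ : Finset (Fin d)).image fun j => (v₀.1, j) := by
    intro v hv
    rw [Finset.mem_image]
    exact ⟨v.2, Finset.mem_univ _, Prod.ext (hcon v hv v₀ hv₀).symm rfl⟩
  have heq : α.support = (Finset.univ : Finset (Fin d)).image fun j => (v₀.1, j) :=
    Finset.eq_of_subset_of_card_le hsub (by
      rw [hcard]
      exact Finset.card_image_le.trans (by simp))
  apply hrow v₀.1
  ext v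
  rw [rowExp_apply]
  by_cases hv : v.1 = v₀.1
  · rw [if_pos hv]
    have hmem : v ∈ α.support := by
      rw [heq, Finset.mem_image]
      exact ⟨v.2, Finset.mem_univ _, Prod.ext hv.symm rfl⟩
    exact le_antisymm (hml v) (Nat.one_le_iff_ne_zero.2 (Finsupp.mem_support_iff.1 hmem))
  · rw [if_neg hv]
    by_contra hne
    have hmem : v ∈ α.support := Finsupp.mem_support_iff.2 hne
    rw [heq, Finset.mem_image] at hmem
    obtain ⟨j, _, hj⟩ := hmem
    exact hv (by rw [← hj])

end PairTensor

/-! ### Transfer to the orbit `g(Ax + b)`: renaming, chain rule, injectivity, homogeneity -/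

section Transfer

variable {K : Type*} [Field K] {m n s d : ℕ}

/-- `T_{s,d}` (tree, indices `finProdFinEquiv (i, j)`) is the renaming of the pair-indexed tensor.
[cite: MediniShpilka2021, Def 40 (arXiv p0008:L51-L53)] -/
theorem sdm_eq_rename (K : Type*) [Field K] (s d : ℕ) :
    sdm K s d = rename finProdFinEquiv (∑ a : Fin s, ∏ j : Fin d, X (a, j)) := by
  simp [sdm, map_sum, map_prod, rename_X]

/-- Members of the LINEAR orbit `T_{s,d}^{GL_n}` presented on the pair-indexed tensor.
[cite: MediniShpilka2021, §1.1.6 and Def 40 (arXiv p0007:L20, p0008:L51-L55)] -/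
theorem exists_affSubst_of_mem_linOrbit_sdm {f : MvPolynomial (Fin n) K}
    (hf : f ∈ linOrbit n (sdm K s d)) :
    ∃ (h : s * d ≤ n) (A : Matrix (Fin n) (Fin n) K), IsUnit A.det ∧
      f = affSubst h A 0 (rename finProdFinEquiv (∑ a : Fin s, ∏ j : Fin d, X (a, j))) := by
  obtain ⟨h, A, hA, rfl⟩ := hf
  exact ⟨h, A, hA, by rw [sdm_eq_rename]⟩

/-- `g ↦ g(Ax + b)` is injective for `A ∈ GL_n` (inverse substitution).
[cite: MediniShpilka2021, §1.1.6 (arXiv p0007:L7-L18)] -/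
theorem eq_zero_of_affSubst_eq_zero (h : m ≤ n) {A : Matrix (Fin n) (Fin n) K} (hA : IsUnit A.det)
    (b : Fin n → K) {p : MvPolynomial (Fin m) K} (hp : affSubst h A b p = 0) : p = 0 := by
  have key := aeval_affine_inv_apply hA b (rename (Fin.castLE h) p)
  rw [← affSubst_eq_aeval_rename, hp, map_zero] at key
  exact rename_injective _ (Fin.castLE_injective h) (by rw [map_zero]; exact key.symm)

/-- The same chain rule with the inner polynomial presented on pair indices.
[cite: MediniShpilka2021, Lemma 3.8 (arXiv p0017:L61-L68)] -/
theorem dirDeriv_affSubst_rename (h : s * d ≤ n) (A : Matrix (Fin n) (Fin n) K) (b : Fin n → K)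
    (v : Fin n → K) (q : MvPolynomial (Fin s × Fin d) K) :
    (∑ j, C (v j) * pderiv j (affSubst h A b (rename finProdFinEquiv q))) =
      affSubst h A b (rename finProdFinEquiv
        (∑ w, C ((A *ᵥ v) (Fin.castLE h (finProdFinEquiv w))) * pderiv w q)) := by
  rw [dirDeriv_affSubst]
  congr 1
  rw [map_sum]
  refine (Fintype.sum_equiv finProdFinEquiv _ _ fun w => ?_).symm
  rw [map_mul, rename_C, pderiv_rename finProdFinEquiv.injective]

/-- **Lemma 3.8 on pair indices**: along the dual vector `v_w₀` (column of `A⁻¹`) the derivative of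
`q(ℓ(x))` is `(∂q/∂y_{w₀})(ℓ(x))`. [cite: MediniShpilka2021, Lemma 3.8 (arXiv p0017:L61-L68)] -/
theorem dualDeriv_affSubst_rename (h : s * d ≤ n) {A : Matrix (Fin n) (Fin n) K} (hA : IsUnit A.det)
    (b : Fin n → K) (w₀ : Fin s × Fin d) (q : MvPolynomial (Fin s × Fin d) K) :
    (∑ j, C (A⁻¹ j (Fin.castLE h (finProdFinEquiv w₀))) *
        pderiv j (affSubst h A b (rename finProdFinEquiv q))) =
      affSubst h A b (rename finProdFinEquiv (pderiv w₀ q)) := by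
  rw [sum_C_mul_pderiv_affSubst h hA b _ (finProdFinEquiv w₀),
    pderiv_rename finProdFinEquiv.injective]

/-- `g(Ax)` is homogeneous of degree `k` when `g` is. [cite: MediniShpilka2021, Obs 2.1 (arXiv p0014:L27)] -/
theorem isHomogeneous_affSubst_zero (h : m ≤ n) (A : Matrix (Fin n) (Fin n) K)
    {p : MvPolynomial (Fin m) K} {k : ℕ} (hp : p.IsHomogeneous k) :
    (affSubst h A 0 p).IsHomogeneous k := by
  unfold affSubst
  have hlin : ∀ i : Fin m, ((∑ j : Fin n, C (A (Fin.castLE h i) j) * X j) +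
      C ((0 : Fin n → K) (Fin.castLE h i)) : MvPolynomial (Fin n) K).IsHomogeneous 1 := by
    intro i
    rw [Pi.zero_apply, C_0, add_zero]
    exact IsHomogeneous.sum _ _ _ fun j _ => isHomogeneous_C_mul_X _ _
  have := hp.aeval _ hlin
  rwa [one_mul] at this

/-- Composition with a UNIFORM map (all coordinates homogeneous of degree `e`) multiplies degrees.
[cite: MediniShpilka2021, Def 19 ("uniform") and proof of Thm 45 ("as G₆ is uniform, deg(f₁ ∘ G₆) = d₁ · deg(G₆)", arXiv p0036:L8)] -/
theorem isHomogeneous_bind₁_of_forall {τ : Type*} {f : MvPolynomial (Fin n) K} {k e : ℕ}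
    (hf : f.IsHomogeneous k) (G : Fin n → MvPolynomial τ K) (he : ∀ j, (G j).IsHomogeneous e) :
    (bind₁ G f).IsHomogeneous (k * e) := by
  rw [← aeval_eq_bind₁, mul_comm]
  exact hf.aeval G he

/-- The rows `castLE h w`, `w < m`, of an invertible matrix are linearly independent.
[cite: MediniShpilka2021, Def 40 ("`sd` linearly independent linear functions") (arXiv p0008:L51-L55)] -/
theorem linearIndependent_rows_castLE (h : m ≤ n) {A : Matrix (Fin n) (Fin n) K}
    (hA : IsUnit A.det) : LinearIndependent K (fun w : Fin m => A (Fin.castLE h w)) := by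
  classical
  have hrows := Matrix.linearIndependent_rows_of_isUnit ((Matrix.isUnit_iff_isUnit_det A).2 hA)
  exact hrows.comp _ (Fin.castLE_injective h)

/-- **Representing `f₂` in the `ℓ_1`-coordinates** ("we can represent `f₂` as a polynomial in
`{ℓ_{1,i,j}}`"): if every form of the second presentation is the combination `∑_w M_{v,w} ℓ_{1,w}`
of the forms of the first, then `q(ℓ_2(x)) = (q ∘ M)(ℓ_1(x))`.
[cite: MediniShpilka2021, proof of Thm 45 (arXiv p0036:L26-L28)] -/
theorem affSubst_rename_eq_of_rows_eq {s₁ s₂ : ℕ} (h₁ : s₁ * d ≤ n) (h₂ : s₂ * d ≤ n)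
    (A₁ A₂ : Matrix (Fin n) (Fin n) K) (M : Fin s₂ × Fin d → Fin s₁ × Fin d → K)
    (hM : ∀ v k, A₂ (Fin.castLE h₂ (finProdFinEquiv v)) k =
      ∑ w, M v w * A₁ (Fin.castLE h₁ (finProdFinEquiv w)) k)
    (q : MvPolynomial (Fin s₂ × Fin d) K) :
    affSubst h₂ A₂ 0 (rename finProdFinEquiv q) =
      affSubst h₁ A₁ 0 (rename finProdFinEquiv (aeval (fun v => ∑ w, C (M v w) * X w) q)) := by
  unfold affSubst
  rw [aeval_rename, aeval_rename, ← AlgHom.comp_apply, comp_aeval]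
  congr 1
  ext1 v
  simp only [Function.comp_apply, map_sum, map_mul, algHom_C, algebraMap_eq, aeval_X, Pi.zero_apply,
    C_0, add_zero, hM, Finset.mul_sum, Finset.sum_mul]
  refine Finset.sum_comm.trans (Finset.sum_congr rfl fun w _ => Finset.sum_congr rfl fun k _ => ?_)
  ring

end Transfer

/-! ### Linear algebra of the two families of linear forms -/

section LinAlg

variable {K : Type*} [Field K] {n : ℕ}

/-- "Fix a vector `v` such that `ℓ_{1,1,1}(v) = 1` and `ℓ_{2,i,j}(v) = 0` for all `i, j`" — possible
as soon as `ℓ_{1,1,1} ∉ span{ℓ_{2,i,j}}`. [cite: MediniShpilka2021, proof of Thm 45 (arXiv p0036:L18-L19)] -/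
theorem exists_dotProduct_eq_one_of_notMem_span {ι : Type*} (L : ι → (Fin n → K)) (w : Fin n → K)
    (hw : w ∉ Submodule.span K (Set.range L)) :
    ∃ v : Fin n → K, w ⬝ᵥ v = 1 ∧ ∀ i, L i ⬝ᵥ v = 0 := by
  classical
  obtain ⟨φ, hφw, hφ⟩ := Submodule.exists_dual_map_eq_bot_of_notMem hw inferInstance
  have hrep : ∀ u : Fin n → K, (u ⬝ᵥ fun k => φ (Pi.single k 1)) = φ u := by
    intro u
    have hu : u = ∑ k, u k • (Pi.single k (1 : K) : Fin n → K) := by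
      funext k'
      simp [Finset.sum_apply, Pi.single_apply]
    conv_rhs => rw [hu, map_sum]
    simp only [map_smul, smul_eq_mul, dotProduct]
  have hscale : ∀ u : Fin n → K, (u ⬝ᵥ fun k => (φ w)⁻¹ * φ (Pi.single k 1)) =
      (φ w)⁻¹ * (u ⬝ᵥ fun k => φ (Pi.single k 1)) := by
    intro u
    simp only [dotProduct, Finset.mul_sum]
    exact Finset.sum_congr rfl fun k _ => by ring
  refine ⟨fun k => (φ w)⁻¹ * φ (Pi.single k 1), ?_, fun i => ?_⟩
  · rw [hscale, hrep, inv_mul_cancel₀ hφw]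
  · rw [hscale, hrep]
    have hLi : φ (L i) ∈ (Submodule.span K (Set.range L)).map φ :=
      Submodule.mem_map_of_mem (Submodule.subset_span ⟨i, rfl⟩)
    rw [hφ, Submodule.mem_bot] at hLi
    rw [hLi, mul_zero]

/-- Two linearly independent families with the same span have the same size (so equal spans force
`s₁ d = s₂ d`: "the proof above also shows that it must be the case that `span{ℓ_1} = span{ℓ_2}`").
[cite: MediniShpilka2021, proof of Thm 45 (arXiv p0036:L16-L24)] -/
theorem card_eq_of_span_eq {ι₁ ι₂ : Type*} [Fintype ι₁] [Fintype ι₂] {L₁ : ι₁ → (Fin n → K)}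
    {L₂ : ι₂ → (Fin n → K)} (h₁ : LinearIndependent K L₁) (h₂ : LinearIndependent K L₂)
    (h : Submodule.span K (Set.range L₁) = Submodule.span K (Set.range L₂)) :
    Fintype.card ι₁ = Fintype.card ι₂ := by
  rw [← finrank_span_eq_card h₁, ← finrank_span_eq_card h₂, h]

/-- Change of basis inside a common span: "we can represent `f₂` as a polynomial in `{ℓ_{1,i,j}}`".
[cite: MediniShpilka2021, proof of Thm 45 (arXiv p0036:L26)] -/
theorem exists_matrix_of_forall_mem_span {ι₁ ι₂ : Type*} [Fintype ι₁] (L₁ : ι₁ → (Fin n → K))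
    (L₂ : ι₂ → (Fin n → K)) (h : ∀ i, L₂ i ∈ Submodule.span K (Set.range L₁)) :
    ∃ M : ι₂ → ι₁ → K, ∀ i k, L₂ i k = ∑ w, M i w * L₁ w k := by
  choose c hc using fun i => (Submodule.mem_span_range_iff_exists_fun (R := K)).1 (h i)
  refine ⟨c, fun i k => ?_⟩
  have := congr_fun (hc i) k
  rw [Finset.sum_apply] at this
  simpa [Pi.smul_apply, smul_eq_mul] using this.symm

end LinAlg

/-! ### Uniform independent maps have positive degree -/

section Uniform

variable {K : Type*} [Field K] {n c k : ℕ}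

/-- The common degree `e` of the coordinates of a UNIFORM `k`-independent map into `K^n` (`k ≥ 1`,
`n ≥ 1`) is at least `1`: the block evaluation of Def 19 sends `G_i ↦ z`, which no constant does
("`deg(f₁ ∘ G₆) = d₁ · deg(G₆)`" is used with `deg(G₆) ≥ 1`).
[cite: MediniShpilka2021, Def 19 and proof of Thm 45 (arXiv p0006:L64-L67, p0036:L8-L9)] -/
theorem one_le_of_isUniform_isIndependent {G : Fin n → MvPolynomial (Fin k × (Fin c ⊕ Unit)) K}
    (hG : IsIndependent k G) (hk : 1 ≤ k) {e : ℕ} (he : ∀ j, (G j).IsHomogeneous e) (i : Fin n) :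
    1 ≤ e := by
  classical
  obtain ⟨φ, hφ⟩ := hG.exists_aeval_eq_single hk i
  by_contra h0
  have he0 : e = 0 := by omega
  have hdeg : (G i).totalDegree = 0 := by
    have := (he i).totalDegree_le
    rw [he0] at this
    exact Nat.le_zero.1 this
  rw [totalDegree_eq_zero_iff_eq_C] at hdeg
  have h1 := hφ i
  rw [if_pos rfl, hdeg, algHom_C, algebraMap_eq] at h1
  have h2 := congr_arg (coeff (Finsupp.single () 1)) h1
  rw [coeff_C, coeff_X, if_neg (Finsupp.single_ne_zero.mpr one_ne_zero).symm, if_pos rfl] at h2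
  exact zero_ne_one h2

end Uniform

end MS2021

end Literature.Computability.AlgebraicComplexity

end
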